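import Mathlib
import Summits.MatrixMultiplication.MatrixMultiplication.Theorems.SoloInformedCwTwoDigits

/-!
# Rigidity of group realizations of Kronecker powers of `cw₂`

The small Coppersmith–Winograd tensor `cw₂ ∈ (ℂ³)^{⊗3}` is, over `ℂ`, isomorphic to the
permutation-type tensor `Σ_{σ ∈ S₃} e_{σ0} ⊗ e_{σ1} ⊗ e_{σ2}`; its `N`-th Kronecker power has
support `S_N = {(u,v,w) ∈ (F₃^N)³ : {u_k, v_k, w_k} = {0,1,2} for every k}`.  A *group realization*
of this support in a group `G` is a triple of maps `s₁ s₂ s₃ : (Fin N → Fin 3) → G` with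
`s₁ u * s₂ v * s₃ w = 1` for all `(u,v,w) ∈ S_N` (if moreover the product is `≠ 1` off `S_N`, the
structure tensor of `ℂ[G]` restricts monomially to `cw₂^{⊠N}` and `R(cw₂^{⊠N}) ≤ Σ dᵢ³`; weighted
versions give monomial DEGENERATIONS and bound the border rank; the base case `N = 1`, `|G| = 4`
is Alman–Vassilevska Williams, *Limits on all known (and some unknown) approaches to matrix
multiplication*, FOCS 2018 = arXiv:1810.08671, Thm. 7.2).

**Theorem (new here, soloist door D6).**  Every group realization is DIGITAL: there are digit
maps `g k : Fin 3 → G` (`k : Fin N`) with `g k 0 = 1`, ALL of whose values pairwise commute, such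
that, writing `P u = g 0 (u 0) * g 1 (u 1) * ⋯ * g (N-1) (u (N-1))`,
`s₁ u = s₁ 0 * P u`, `s₂ v = P v * s₂ 0` and
`s₃ w = (s₂ 0)⁻¹ * P w * (P 1 * P 2)⁻¹ * (s₁ 0)⁻¹` (`exists_digits_of_realizes`); conversely every
such triple is a realization (`realizes_of_digits`).  Consequently the realized tensor is a block
of the structure tensor of the ABELIAN subgroup generated by the digits
(`exists_commutative_subgroup_of_realizes`): non-abelian groups contribute nothing beyond their
abelian subgroups, and the search for such realizations is a finite digit-design problem in finite
abelian groups.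

No `sorry`; axioms `propext`, `Classical.choice`, `Quot.sound`.
-/

namespace Summit.MatrixMultiplication.MatrixMultiplication.Theorems

open Function

section CwTwoGroupRigidity

variable {G : Type*} [Group G] {N : ℕ}

/-- **Pair invariance.** In a realization, `s₁ u * s₂ v` depends only on the coordinatewise
third letters `-u_i - v_i` (both products equal `(s₃ w)⁻¹` for the common completion `w`). -/
theorem pair_eq_of_realizes (s₁ s₂ s₃ : (Fin N → Fin 3) → G)
    (h : ∀ u v w : Fin N → Fin 3, (∀ i, u i ≠ v i ∧ v i ≠ w i ∧ u i ≠ w i) →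
      s₁ u * s₂ v * s₃ w = 1)
    (u v u' v' : Fin N → Fin 3) (huv : ∀ i, u i ≠ v i) (huv' : ∀ i, u' i ≠ v' i)
    (hthird : ∀ i, -u i - v i = -u' i - v' i) : s₁ u * s₂ v = s₁ u' * s₂ v' := by
  set w : Fin N → Fin 3 := fun i => -u i - v i with hw
  have h1 : s₁ u * s₂ v * s₃ w = 1 :=
    h u v w (fun i => ⟨huv i, (fin3_third_ne _ _ (huv i)).1, (fin3_third_ne _ _ (huv i)).2⟩)
  have h2 : s₁ u' * s₂ v' * s₃ w = 1 := by
    refine h u' v' w (fun i => ⟨huv' i, ?_, ?_⟩)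
    · show v' i ≠ -u i - v i
      rw [hthird i]; exact (fin3_third_ne _ _ (huv' i)).1
    · show u' i ≠ -u i - v i
      rw [hthird i]; exact (fin3_third_ne _ _ (huv' i)).2
  rw [eq_inv_of_mul_eq_one_left h1, eq_inv_of_mul_eq_one_left h2]

/-- **Right digits of `s₁` are well defined**: the quotient
`(s₁ u[k:=b])⁻¹ * s₁ u[k:=a]` does not depend on the other coordinates of `u`. -/
theorem rquot_eq_of_realizes (s₁ s₂ s₃ : (Fin N → Fin 3) → G)
    (h : ∀ u v w : Fin N → Fin 3, (∀ i, u i ≠ v i ∧ v i ≠ w i ∧ u i ≠ w i) →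
      s₁ u * s₂ v * s₃ w = 1)
    (u u' : Fin N → Fin 3) (k : Fin N) (a b : Fin 3) :
    (s₁ (update u k b))⁻¹ * s₁ (update u k a) =
      (s₁ (update u' k b))⁻¹ * s₁ (update u' k a) := by
  by_cases hab : a = b
  · subst hab; simp
  -- a common partner word `v`: letter `b` at `k`, avoiding `u` and `u'` elsewhere
  set v : Fin N → Fin 3 := fun j => if j = k then b else
    (if u j = u' j then u j + 1 else -u j - u' j) with hv
  have hvk : v k = b := by simp [hv]
  have hvj : ∀ j, j ≠ k → v j ≠ u j ∧ v j ≠ u' j := by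
    intro j hj; simp only [hv, if_neg hj]; exact fin3_avoid_ne _ _
  have key : ∀ x : Fin N → Fin 3, (∀ j, j ≠ k → v j ≠ x j) →
      (s₁ (update x k b))⁻¹ * s₁ (update x k a) = s₂ (update v k a) * (s₂ v)⁻¹ := by
    intro x hx
    apply inv_mul_eq_mul_inv_of_mul_eq_mul
    apply pair_eq_of_realizes s₁ s₂ s₃ h
    · intro i
      by_cases hi : i = k
      · subst hi; simpa [hvk] using hab
      · simpa [update_apply, hi] using fun e => hx i hi e.symm
    · intro i
      by_cases hi : i = k
      · subst hi; simpa using fun e => hab e.symm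
      · simpa [update_apply, hi] using fun e => hx i hi e.symm
    · intro i
      by_cases hi : i = k
      · subst hi; simpa [hvk] using fin3_third_symm a b
      · simp [hi]
  rw [key u (fun j hj => (hvj j hj).1), key u' (fun j hj => (hvj j hj).2)]

/-- The rotated triple `(s₂, s₃, s₁)` is again a realization. -/
theorem realizes_rotate (s₁ s₂ s₃ : (Fin N → Fin 3) → G)
    (h : ∀ u v w : Fin N → Fin 3, (∀ i, u i ≠ v i ∧ v i ≠ w i ∧ u i ≠ w i) →
      s₁ u * s₂ v * s₃ w = 1) :
    ∀ v w u : Fin N → Fin 3, (∀ i, v i ≠ w i ∧ w i ≠ u i ∧ v i ≠ u i) →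
      s₂ v * s₃ w * s₁ u = 1 := by
  intro v w u hadm
  have := h u v w (fun i => ⟨(hadm i).2.2.symm, (hadm i).1, (hadm i).2.1.symm⟩)
  calc s₂ v * s₃ w * s₁ u = (s₁ u)⁻¹ * (s₁ u * s₂ v * s₃ w) * s₁ u := by group
    _ = 1 := by rw [this]; group

/-- **Rigidity theorem (digital structure of group realizations of `cw₂^{⊠N}`).**
If `s₁ u * s₂ v * s₃ w = 1` whenever `{u_i, v_i, w_i} = {0,1,2}` for all `i`, then with the digits
`g k a := (s₁ 0)⁻¹ * s₁ (0[k:=a])` — which satisfy `g k 0 = 1` and pairwise COMMUTE — one has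
`s₁ u = s₁ 0 * P u`, `s₂ v = P v * s₂ 0`, `s₃ w = (s₂ 0)⁻¹ * P w * (P 1 * P 2)⁻¹ * (s₁ 0)⁻¹`,
where `P u = digitProd g u N` is the ordered digit product. -/
theorem exists_digits_of_realizes (s₁ s₂ s₃ : (Fin N → Fin 3) → G)
    (h : ∀ u v w : Fin N → Fin 3, (∀ i, u i ≠ v i ∧ v i ≠ w i ∧ u i ≠ w i) →
      s₁ u * s₂ v * s₃ w = 1) :
    ∃ g : Fin N → Fin 3 → G,
      (∀ k, g k 0 = 1) ∧
      (∀ k l a c, Commute (g k a) (g l c)) ∧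
      (∀ u, s₁ u = s₁ 0 * digitProd g u N) ∧
      (∀ v, s₂ v = digitProd g v N * s₂ 0) ∧
      (∀ w, s₃ w = (s₂ 0)⁻¹ * digitProd g w N *
          (digitProd g (fun _ => 1) N * digitProd g (fun _ => 2) N)⁻¹ * (s₁ 0)⁻¹) := by
  set g : Fin N → Fin 3 → G := fun k a => (s₁ 0)⁻¹ * s₁ (update 0 k a) with hg
  have hg0 : ∀ k, g k 0 = 1 := by
    intro k; simp [hg]
  -- right steps for `s₁`
  have rstep : ∀ (u : Fin N → Fin 3) (k : Fin N) (a : Fin 3),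
      s₁ (update u k a) = s₁ (update u k 0) * g k a := by
    intro u k a
    have e := rquot_eq_of_realizes s₁ s₂ s₃ h u 0 k a 0
    rw [show update (0 : Fin N → Fin 3) k 0 = 0 from update_eq_self k 0] at e
    calc s₁ (update u k a) = s₁ (update u k 0) * ((s₁ (update u k 0))⁻¹ * s₁ (update u k a)) := by
          group
      _ = s₁ (update u k 0) * g k a := by rw [e]
  -- left steps for `s₂`
  have lstep : ∀ (v : Fin N → Fin 3) (k : Fin N) (a : Fin 3),
      s₂ (update v k a) = g k a * s₂ (update v k 0) := by
    intro v k a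
    by_cases ha : a = 0
    · subst ha; simp [hg0]
    set x : Fin N → Fin 3 := fun j => v j + 1 with hx
    have e : s₁ (update x k 0) * s₂ (update v k a) = s₁ (update x k a) * s₂ (update v k 0) := by
      apply pair_eq_of_realizes s₁ s₂ s₃ h
      · intro i; by_cases hi : i = k
        · subst hi; simpa using fun e => ha e.symm
        · simp [hi, hx]
      · intro i; by_cases hi : i = k
        · subst hi; simpa using ha
        · simp [hi, hx]
      · intro i; by_cases hi : i = k
        · subst hi; simp
        · simp [hi]
    have e2 := rquot_eq_of_realizes s₁ s₂ s₃ h x 0 k a 0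
    rw [show update (0 : Fin N → Fin 3) k 0 = 0 from update_eq_self k 0] at e2
    -- `g k a = (s₁ x[k:=0])⁻¹ * s₁ x[k:=a]`
    calc s₂ (update v k a) = (s₁ (update x k 0))⁻¹ * (s₁ (update x k 0) * s₂ (update v k a)) := by
          group
      _ = (s₁ (update x k 0))⁻¹ * s₁ (update x k a) * s₂ (update v k 0) := by
          rw [e]; group
      _ = g k a * s₂ (update v k 0) := by rw [e2]
  -- commutation of digits
  have hcomm : ∀ k l a c, Commute (g k a) (g l c) := by
    intro k l a c
    by_cases hkl : k = l
    · subst hkl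
      -- same coordinate: compare `s₁ x[k:=a] * s₂ y[k:=c]` with `s₁ x[k:=c] * s₂ y[k:=a]`
      by_cases hac : a = c
      · subst hac; exact Commute.refl _
      set y : Fin N → Fin 3 := fun _ => 1 with hy
      have e : s₁ (update 0 k a) * s₂ (update y k c) = s₁ (update 0 k c) * s₂ (update y k a) := by
        apply pair_eq_of_realizes s₁ s₂ s₃ h
        · intro i; by_cases hi : i = k
          · subst hi; simpa using hac
          · simp [hi, hy]
        · intro i; by_cases hi : i = k
          · subst hi; simpa using fun e => hac e.symm
          · simp [hi, hy]
        · intro i; by_cases hi : i = k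
          · subst hi; simpa using fin3_third_symm a c
          · simp [hi]
      rw [rstep 0 k a, rstep 0 k c, lstep y k c, lstep y k a,
        show update (0 : Fin N → Fin 3) k 0 = 0 from update_eq_self k 0] at e
      -- e : s₁ 0 * g k a * (g k c * s₂ y[k:=0]) = s₁ 0 * g k c * (g k a * s₂ y[k:=0])
      have : g k a * g k c = g k c * g k a := by
        have e' := congrArg (fun t => (s₁ 0)⁻¹ * t * (s₂ (update y k 0))⁻¹) e
        simpa [mul_assoc] using e'
      exact this
    · -- different coordinates: evaluate `s₁ 0[k:=a][l:=c]` in two ways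
      have hlk : l ≠ k := fun e => hkl e.symm
      have e1 : s₁ (update (update 0 k a) l c) = s₁ 0 * g k a * g l c := by
        rw [rstep (update 0 k a) l c,
          show update (update (0 : Fin N → Fin 3) k a) l 0 = update (0 : Fin N → Fin 3) k a from by
            rw [update_eq_iff]; exact ⟨by simp [hlk], fun j hj => rfl⟩,
          rstep 0 k a, show update (0 : Fin N → Fin 3) k 0 = 0 from update_eq_self k 0]
      have e2 : s₁ (update (update 0 l c) k a) = s₁ 0 * g l c * g k a := by
        rw [rstep (update 0 l c) k a,
          show update (update (0 : Fin N → Fin 3) l c) k 0 = update (0 : Fin N → Fin 3) l c from by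
            rw [update_eq_iff]; exact ⟨by simp [hkl], fun j hj => rfl⟩,
          rstep 0 l c, show update (0 : Fin N → Fin 3) l 0 = 0 from update_eq_self l 0]
      rw [update_comm hkl] at e1
      rw [e1] at e2
      have e3 := congrArg (fun t => (s₁ 0)⁻¹ * t) e2
      simp only [← mul_assoc, inv_mul_cancel, one_mul] at e3
      exact e3
  -- closed forms for `s₁` (filling in coordinates from the left) and `s₂` (zeroing them out)
  have H1 : ∀ u, s₁ u = s₁ 0 * digitProd g u N := by
    intro u
    have main : ∀ m : ℕ, s₁ (fun i => if (i : ℕ) < m then u i else (0 : Fin N → Fin 3) i) =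
        s₁ 0 * digitProd g u m := by
      intro m
      induction m with
      | zero => simp [digitProd]; try rfl
      | succ m ih =>
        simp only [digitProd]
        split_ifs with hm
        · rw [splice_succ u 0 hm (u ⟨m, hm⟩) rfl, rstep, splice_update_cut u 0 hm 0 rfl, ih,
            mul_assoc]
        · rw [splice_stable u 0 hm, ih, mul_one]
    have := main N
    rwa [splice_top] at this
  have H2 : ∀ v, s₂ v = digitProd g v N * s₂ 0 := by
    intro v
    have main : ∀ m : ℕ, s₂ v =
        digitProd g v m * s₂ (fun i => if (i : ℕ) < m then (0 : Fin N → Fin 3) i else v i) := by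
      intro m
      induction m with
      | zero => simp [digitProd]
      | succ m ih =>
        simp only [digitProd]
        split_ifs with hm
        · rw [ih, ← splice_update_cut 0 v hm (v ⟨m, hm⟩) rfl, lstep, ← splice_succ 0 v hm 0 rfl]
          exact (mul_assoc _ _ _).symm
        · rw [splice_stable 0 v hm, mul_one]; exact ih
    have := main N
    rwa [splice_top] at this
  refine ⟨g, hg0, hcomm, H1, H2, ?_⟩
  -- closed form for `s₃` from the equation along the admissible triple `(w+1, w+2, w)`
  intro w
  set u : Fin N → Fin 3 := fun i => w i + 1 with hu
  set v : Fin N → Fin 3 := fun i => w i + 2 with hv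
  have hadm : ∀ i, u i ≠ v i ∧ v i ≠ w i ∧ u i ≠ w i := fun i => fin3_shift_adm (w i)
  have e := h u v w hadm
  rw [H1 u, H2 v] at e
  have hP := digitProd_adm g hg0 hcomm u v w hadm N
  -- from `s₁ 0 * P u * (P v * s₂ 0) * s₃ w = 1`
  have e' : s₃ w = (s₁ 0 * digitProd g u N * (digitProd g v N * s₂ 0))⁻¹ :=
    eq_inv_of_mul_eq_one_right e
  rw [e']
  have hP' : digitProd g u N * digitProd g v N =
      digitProd g (fun _ => 1) N * digitProd g (fun _ => 2) N * (digitProd g w N)⁻¹ := by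
    rw [← hP]; group
  calc (s₁ 0 * digitProd g u N * (digitProd g v N * s₂ 0))⁻¹
      = (s₂ 0)⁻¹ * (digitProd g u N * digitProd g v N)⁻¹ * (s₁ 0)⁻¹ := by group
    _ = (s₂ 0)⁻¹ * digitProd g w N *
        (digitProd g (fun _ => 1) N * digitProd g (fun _ => 2) N)⁻¹ * (s₁ 0)⁻¹ := by
        rw [hP']; group

/-- **Converse**: any two constants and any family of pairwise commuting digits with `g k 0 = 1`
give a realization by the formulas of `exists_digits_of_realizes`. -/
theorem realizes_of_digits (g : Fin N → Fin 3 → G) (hg0 : ∀ k, g k 0 = 1)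
    (hcomm : ∀ k l a c, Commute (g k a) (g l c)) (a b : G)
    (s₁ s₂ s₃ : (Fin N → Fin 3) → G)
    (h₁ : ∀ u, s₁ u = a * digitProd g u N) (h₂ : ∀ v, s₂ v = digitProd g v N * b)
    (h₃ : ∀ w, s₃ w = b⁻¹ * digitProd g w N *
        (digitProd g (fun _ => 1) N * digitProd g (fun _ => 2) N)⁻¹ * a⁻¹) :
    ∀ u v w : Fin N → Fin 3, (∀ i, u i ≠ v i ∧ v i ≠ w i ∧ u i ≠ w i) →
      s₁ u * s₂ v * s₃ w = 1 := by
  intro u v w hadm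
  rw [h₁, h₂, h₃]
  have hP := digitProd_adm g hg0 hcomm u v w hadm N
  calc a * digitProd g u N * (digitProd g v N * b) *
        (b⁻¹ * digitProd g w N * (digitProd g (fun _ => 1) N * digitProd g (fun _ => 2) N)⁻¹ * a⁻¹)
      = a * (digitProd g u N * digitProd g v N * digitProd g w N) *
          (digitProd g (fun _ => 1) N * digitProd g (fun _ => 2) N)⁻¹ * a⁻¹ := by group
    _ = 1 := by rw [hP]; group

/-- **Corollary (non-abelian groups give nothing new).**  For a realization there is a
COMMUTATIVE subgroup `H ≤ G` (generated by the digits) such that `s₁` takes values in the coset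
`s₁ 0 · H`, `s₂` in `H · s₂ 0`, and `s₃` in `(s₂ 0)⁻¹ · H · (s₁ 0)⁻¹`; the realized tensor
`[s₁ u s₂ v s₃ w = 1]` is therefore a block of the structure tensor of the abelian group `H`. -/
theorem exists_commutative_subgroup_of_realizes (s₁ s₂ s₃ : (Fin N → Fin 3) → G)
    (h : ∀ u v w : Fin N → Fin 3, (∀ i, u i ≠ v i ∧ v i ≠ w i ∧ u i ≠ w i) →
      s₁ u * s₂ v * s₃ w = 1) :
    ∃ H : Subgroup G, (∀ x ∈ H, ∀ y ∈ H, x * y = y * x) ∧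
      (∀ u, (s₁ 0)⁻¹ * s₁ u ∈ H) ∧ (∀ v, s₂ v * (s₂ 0)⁻¹ ∈ H) ∧
      (∀ w, s₂ 0 * s₃ w * s₁ 0 ∈ H) := by
  obtain ⟨g, hg0, hcomm, h₁, h₂, h₃⟩ := exists_digits_of_realizes s₁ s₂ s₃ h
  set S : Set G := Set.range (fun p : Fin N × Fin 3 => g p.1 p.2) with hSdef
  have hS : ∀ x ∈ S, ∀ y ∈ S, x * y = y * x := by
    rintro x ⟨⟨k, a⟩, rfl⟩ y ⟨⟨l, c⟩, rfl⟩
    exact (hcomm k l a c).eq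
  have hgS : ∀ k a, g k a ∈ Subgroup.closure S :=
    fun k a => Subgroup.subset_closure ⟨(k, a), rfl⟩
  refine ⟨Subgroup.closure S, ?_, ?_, ?_, ?_⟩
  · intro x hx y hy
    have hc := Subgroup.isMulCommutative_closure hS
    have e := hc.is_comm.comm (⟨x, hx⟩ : Subgroup.closure S) ⟨y, hy⟩
    simpa using congrArg Subtype.val e
  · intro u
    rw [h₁ u, ← mul_assoc, inv_mul_cancel, one_mul]
    exact digitProd_mem g _ hgS u N
  · intro v
    rw [h₂ v, mul_assoc, mul_inv_cancel, mul_one]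
    exact digitProd_mem g _ hgS v N
  · intro w
    rw [h₃ w]
    have e : s₂ 0 * ((s₂ 0)⁻¹ * digitProd g w N *
        (digitProd g (fun _ => 1) N * digitProd g (fun _ => 2) N)⁻¹ * (s₁ 0)⁻¹) * s₁ 0 =
        digitProd g w N * (digitProd g (fun _ => 1) N * digitProd g (fun _ => 2) N)⁻¹ := by
      group
    rw [e]
    exact Subgroup.mul_mem _ (digitProd_mem g _ hgS w N)
      (Subgroup.inv_mem _ (Subgroup.mul_mem _ (digitProd_mem g _ hgS _ N)
        (digitProd_mem g _ hgS _ N)))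

end CwTwoGroupRigidity

end Summit.MatrixMultiplication.MatrixMultiplication.Theorems
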